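import Mathlib

/-!
# A two-sided Fatou sandwich (K3 helper, pure measure theory)

Helper file for stub `stub_antiDampedGirsanov` (K3) of line `lebesgue-flip-duality`, crux ★
`BondHeatUncertainty.LinearResponseFTUR` (stmt-AtomisticToContinuum-9122). The abstract limit step of
the anti-damped Girsanov formula: suppose that for every truncation level `R : ℕ` and mesh index `m` two
measurable functionals `f R m, g R m ≥ 0` on a probability space have EQUAL integrals (a discrete
change-of-variables identity), that `g ≤ C`, that `f R m → F` almost surely on a measurable event `A R`
and `g R m → Gl` pointwise on a measurable event `B R` as `m → ∞`, and that the events `A R`, `B R`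
increase to the whole space. Then `∫ F ≤ ∫ Gl` (`lintegral_le_of_sandwich`): Fatou on the `f`-side,
dominated convergence on the `g`-side restricted to `B R`, and `R → ∞` by monotone convergence /
continuity from above. Also: bounded continuous `ℝ≥0` test functions built from a bound (`bcfOfBound`,
`bcfOne`) and the truncated weights `truncWeight G a n = G · min(e^{a}, n)` with their monotone limit.
-/

noncomputable section

namespace Summit.AtomisticToContinuum.FouriersLaw.Theorems.LinearResponseFTUR

open MeasureTheory Filter Set Function Topology
open scoped NNReal ENNReal

/-- **The Fatou sandwich** (see the module docstring). -/
theorem lintegral_le_of_sandwich {Ω : Type*} [MeasurableSpace Ω] (μ : Measure Ω) [IsProbabilityMeasure μ]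
    (f g : ℕ → ℕ → Ω → ℝ≥0∞) (hf : ∀ R m, Measurable (f R m)) (hg : ∀ R m, Measurable (g R m))
    (hfg : ∀ R m, ∫⁻ ω, g R m ω ∂μ = ∫⁻ ω, f R m ω ∂μ)
    (A B : ℕ → Set Ω) (hA : ∀ R, MeasurableSet (A R)) (hB : ∀ R, MeasurableSet (B R))
    (hAmono : Monotone A) (hBmono : Monotone B) (hAex : ∀ ω, ∃ R, ω ∈ A R) (hBex : ∀ ω, ∃ R, ω ∈ B R)
    (F Gl : Ω → ℝ≥0∞) (hF : Measurable F)
    (hlimf : ∀ R, ∀ᵐ ω ∂μ, ω ∈ A R → Tendsto (fun m => f R m ω) atTop (𝓝 (F ω)))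
    (hlimg : ∀ R ω, ω ∈ B R → Tendsto (fun m => g R m ω) atTop (𝓝 (Gl ω)))
    (C : ℝ≥0) (hgC : ∀ R m ω, g R m ω ≤ C) :
    ∫⁻ ω, F ω ∂μ ≤ ∫⁻ ω, Gl ω ∂μ := by
  -- Step 1: for each `R`, `∫ 1_{A R} F ≤ ∫ Gl + C μ((B R)ᶜ)`
  have hstep : ∀ R : ℕ, ∫⁻ ω, (A R).indicator F ω ∂μ ≤ ∫⁻ ω, Gl ω ∂μ + C * μ (B R)ᶜ := by
    intro R
    -- Fatou on the `f`-side
    have h1 : ∫⁻ ω, (A R).indicator F ω ∂μ ≤ ∫⁻ ω, liminf (fun m => f R m ω) atTop ∂μ := by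
      refine lintegral_mono_ae ?_
      filter_upwards [hlimf R] with ω hω
      by_cases hmem : ω ∈ A R
      · rw [indicator_of_mem hmem, (hω hmem).liminf_eq]
      · rw [indicator_of_notMem hmem]; exact zero_le
    have h2 : ∫⁻ ω, liminf (fun m => f R m ω) atTop ∂μ ≤ liminf (fun m => ∫⁻ ω, f R m ω ∂μ) atTop :=
      lintegral_liminf_le (hf R)
    -- the `g`-side: split on `B R`
    have hsplit : ∀ m, ∫⁻ ω, g R m ω ∂μ ≤ ∫⁻ ω, (B R).indicator (g R m) ω ∂μ + C * μ (B R)ᶜ := by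
      intro m
      have hdecomp : ∀ ω, g R m ω = (B R).indicator (g R m) ω + (B R)ᶜ.indicator (g R m) ω := by
        intro ω
        by_cases hmem : ω ∈ B R
        · rw [indicator_of_mem hmem, indicator_of_notMem (Set.notMem_compl_iff.2 hmem), add_zero]
        · rw [indicator_of_notMem hmem, indicator_of_mem (mem_compl hmem), zero_add]
      calc ∫⁻ ω, g R m ω ∂μ = ∫⁻ ω, (B R).indicator (g R m) ω + (B R)ᶜ.indicator (g R m) ω ∂μ :=
            lintegral_congr hdecomp
        _ = ∫⁻ ω, (B R).indicator (g R m) ω ∂μ + ∫⁻ ω, (B R)ᶜ.indicator (g R m) ω ∂μ :=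
            lintegral_add_left ((hg R m).indicator (hB R)) _
        _ ≤ ∫⁻ ω, (B R).indicator (g R m) ω ∂μ + ∫⁻ ω, (B R)ᶜ.indicator (fun _ => (C : ℝ≥0∞)) ω ∂μ := by
            refine add_le_add le_rfl (lintegral_mono fun ω => ?_)
            exact indicator_le_indicator (hgC R m ω)
        _ = ∫⁻ ω, (B R).indicator (g R m) ω ∂μ + C * μ (B R)ᶜ := by
            rw [lintegral_indicator_const (hB R).compl]
    -- dominated convergence on `B R`
    have hDCT : Tendsto (fun m => ∫⁻ ω, (B R).indicator (g R m) ω ∂μ) atTop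
        (𝓝 (∫⁻ ω, (B R).indicator Gl ω ∂μ)) := by
      refine tendsto_lintegral_of_dominated_convergence (fun _ => (C : ℝ≥0∞))
        (fun m => (hg R m).indicator (hB R)) (fun m => Eventually.of_forall fun ω => ?_) ?_
        (Eventually.of_forall fun ω => ?_)
      · by_cases hmem : ω ∈ B R
        · rw [indicator_of_mem hmem]; exact hgC R m ω
        · rw [indicator_of_notMem hmem]; exact zero_le
      · rw [lintegral_const]; exact ENNReal.mul_ne_top ENNReal.coe_ne_top (measure_ne_top _ _)
      · by_cases hmem : ω ∈ B R
        · simp only [indicator_of_mem hmem]; exact hlimg R ω hmem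
        · simp only [indicator_of_notMem hmem]; exact tendsto_const_nhds
    have h3 : liminf (fun m => ∫⁻ ω, f R m ω ∂μ) atTop ≤
        liminf (fun m => ∫⁻ ω, (B R).indicator (g R m) ω ∂μ + C * μ (B R)ᶜ) atTop := by
      refine liminf_le_liminf (Eventually.of_forall fun m => ?_)
      rw [← hfg R m]
      exact hsplit m
    have h4 : liminf (fun m => ∫⁻ ω, (B R).indicator (g R m) ω ∂μ + C * μ (B R)ᶜ) atTop =
        ∫⁻ ω, (B R).indicator Gl ω ∂μ + C * μ (B R)ᶜ :=
      (hDCT.add_const _).liminf_eq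
    have h5 : ∫⁻ ω, (B R).indicator Gl ω ∂μ ≤ ∫⁻ ω, Gl ω ∂μ :=
      lintegral_mono fun ω => indicator_le_self _ _ ω
    calc ∫⁻ ω, (A R).indicator F ω ∂μ ≤ liminf (fun m => ∫⁻ ω, f R m ω ∂μ) atTop := h1.trans h2
      _ ≤ ∫⁻ ω, (B R).indicator Gl ω ∂μ + C * μ (B R)ᶜ := h3.trans h4.le
      _ ≤ ∫⁻ ω, Gl ω ∂μ + C * μ (B R)ᶜ := add_le_add h5 le_rfl
  -- Step 2: `μ((B R)ᶜ) → 0`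
  have hBc : Tendsto (fun R : ℕ => μ (B R)ᶜ) atTop (𝓝 0) := by
    have hanti : Antitone fun R => (B R)ᶜ := fun R R' h => compl_subset_compl.2 (hBmono h)
    have hinter : ⋂ R, (B R)ᶜ = ∅ := by
      ext ω
      simp only [mem_iInter, mem_compl_iff, mem_empty_iff_false, iff_false, not_forall, not_not]
      exact hBex ω
    have h := tendsto_measure_iInter_atTop (μ := μ) (fun R => (hB R).compl.nullMeasurableSet) hanti
      ⟨0, measure_ne_top _ _⟩
    rwa [hinter, measure_empty] at h
  -- Step 3: for each `R`, `∫ 1_{A R} F ≤ ∫ Gl` (let the other level go to infinity)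
  have hstep' : ∀ R : ℕ, ∫⁻ ω, (A R).indicator F ω ∂μ ≤ ∫⁻ ω, Gl ω ∂μ := by
    intro R
    have hRR : ∀ R', R ≤ R' → ∫⁻ ω, (A R).indicator F ω ∂μ ≤ ∫⁻ ω, Gl ω ∂μ + C * μ (B R')ᶜ := by
      intro R' hRR'
      refine le_trans (lintegral_mono fun ω => ?_) (hstep R')
      exact indicator_le_indicator_of_subset (hAmono hRR') (fun _ => zero_le) ω
    have hlim : Tendsto (fun R' : ℕ => ∫⁻ ω, Gl ω ∂μ + C * μ (B R')ᶜ) atTop (𝓝 (∫⁻ ω, Gl ω ∂μ)) := by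
      have h := (ENNReal.Tendsto.const_mul hBc (Or.inr ENNReal.coe_ne_top) : Tendsto (fun R' : ℕ =>
        (C : ℝ≥0∞) * μ (B R')ᶜ) atTop (𝓝 ((C : ℝ≥0∞) * 0)))
      rw [mul_zero] at h
      simpa using h.const_add (∫⁻ ω, Gl ω ∂μ)
    exact ge_of_tendsto hlim (eventually_atTop.2 ⟨R, hRR⟩)
  -- Step 4: monotone convergence in `R`
  have hmono : Monotone fun R => (A R).indicator F := fun R R' h =>
    indicator_le_indicator_of_subset (hAmono h) fun _ => zero_le
  have hsup : ∀ ω, (⨆ R, (A R).indicator F ω) = F ω := by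
    intro ω
    obtain ⟨R₀, hR₀⟩ := hAex ω
    refine le_antisymm (iSup_le fun R => indicator_le_self _ _ ω) ?_
    exact le_iSup_of_le R₀ (by rw [indicator_of_mem hR₀])
  calc ∫⁻ ω, F ω ∂μ = ∫⁻ ω, ⨆ R, (A R).indicator F ω ∂μ := lintegral_congr fun ω => (hsup ω).symm
    _ = ⨆ R, ∫⁻ ω, (A R).indicator F ω ∂μ := lintegral_iSup (fun R => hF.indicator (hA R)) hmono
    _ ≤ ∫⁻ ω, Gl ω ∂μ := iSup_le hstep'

/-- **Dyadic-rational reduction**: for a process with continuous paths and measurable marginals, the event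
`{∀ s ∈ [0, t], u s ≤ c}` is measurable (it is the intersection over the dyadic nodes `k t/2^m`). -/
theorem measurableSet_forall_Icc_le {Ω : Type*} [MeasurableSpace Ω] {u : ℝ → Ω → ℝ}
    (hc : ∀ ω, Continuous fun s => u s ω) (hm : ∀ s, Measurable (u s)) {t : ℝ} (ht : 0 ≤ t) (c : ℝ) :
    MeasurableSet {ω | ∀ s ∈ Icc 0 t, u s ω ≤ c} := by
  have hset : {ω | ∀ s ∈ Icc 0 t, u s ω ≤ c} =
      ⋂ m : ℕ, ⋂ k : ℕ, ⋂ (_ : k ≤ 2 ^ m), {ω | u ((k : ℝ) * (t / 2 ^ m)) ω ≤ c} := by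
    ext ω
    simp only [mem_setOf_eq, mem_iInter]
    constructor
    · intro h m k hk
      refine h _ ⟨by positivity, ?_⟩
      have hk' : (k : ℝ) ≤ 2 ^ m := by exact_mod_cast hk
      calc (k : ℝ) * (t / 2 ^ m) ≤ 2 ^ m * (t / 2 ^ m) := mul_le_mul_of_nonneg_right hk' (by positivity)
        _ = t := mul_div_cancel₀ _ (pow_ne_zero _ two_ne_zero)
    · intro h s hs
      rcases eq_or_lt_of_le ht with rfl | htpos
      · have hs0 : s = 0 := le_antisymm hs.2 hs.1
        have := h 0 0 (Nat.zero_le _)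
        simp only [Nat.cast_zero, zero_mul] at this
        rwa [hs0]
      -- dyadic approximation from below
      set km : ℕ → ℕ := fun m => ⌊s / (t / 2 ^ m)⌋₊ with hkm
      have hmesh : ∀ m : ℕ, (0 : ℝ) < t / 2 ^ m := fun m => by positivity
      have hkm_le : ∀ m, (km m : ℝ) * (t / 2 ^ m) ≤ s := fun m => by
        have := Nat.floor_le (div_nonneg hs.1 (hmesh m).le)
        rw [hkm]
        exact (le_div_iff₀ (hmesh m)).1 this
      have hkm_gt : ∀ m, s - t / 2 ^ m < (km m : ℝ) * (t / 2 ^ m) := fun m => by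
        have := Nat.lt_floor_add_one (s / (t / 2 ^ m))
        rw [hkm]
        have h2 := (div_lt_iff₀ (hmesh m)).1 this
        linarith [h2, add_mul (⌊s / (t / 2 ^ m)⌋₊ : ℝ) 1 (t / 2 ^ m)]
      have hkm_bound : ∀ m, km m ≤ 2 ^ m := fun m => by
        have h1 : (km m : ℝ) * (t / 2 ^ m) ≤ 2 ^ m * (t / 2 ^ m) := by
          rw [mul_div_cancel₀ _ (pow_ne_zero _ two_ne_zero)]; exact (hkm_le m).trans hs.2
        have h2 := le_of_mul_le_mul_right h1 (hmesh m)
        exact_mod_cast h2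
      have hconv : Tendsto (fun m : ℕ => (km m : ℝ) * (t / 2 ^ m)) atTop (𝓝 s) := by
        have hmesh0 : Tendsto (fun m : ℕ => t / 2 ^ m) atTop (𝓝 0) :=
          tendsto_const_nhds.div_atTop (tendsto_pow_atTop_atTop_of_one_lt one_lt_two)
        have hlow : Tendsto (fun m : ℕ => s - t / 2 ^ m) atTop (𝓝 s) := by
          simpa using (tendsto_const_nhds (x := s)).sub hmesh0
        exact tendsto_of_tendsto_of_tendsto_of_le_of_le hlow tendsto_const_nhds
          (fun m => (hkm_gt m).le) (fun m => hkm_le m)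
      have hlimu : Tendsto (fun m : ℕ => u ((km m : ℝ) * (t / 2 ^ m)) ω) atTop (𝓝 (u s ω)) :=
        ((hc ω).tendsto s).comp hconv
      exact le_of_tendsto' hlimu fun m => h m (km m) (hkm_bound m)
  rw [hset]
  refine MeasurableSet.iInter fun m => MeasurableSet.iInter fun k => MeasurableSet.iInter fun _ => ?_
  exact measurableSet_le (hm _) measurable_const

/-! ### Bounded continuous `ℝ≥0`-valued test functions and truncated weights -/

section BCF

open BoundedContinuousFunction


/-- A continuous `ℝ≥0`-valued function with values in `[0, C]` as a bounded continuous function. -/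
def bcfOfBound {X : Type*} [TopologicalSpace X] (f : X → ℝ≥0) (hf : Continuous f) (C : ℝ≥0)
    (hC : ∀ x, f x ≤ C) : X →ᵇ ℝ≥0 :=
  BoundedContinuousFunction.mkOfBound ⟨f, hf⟩ C fun x y => by
    show dist (f x) (f y) ≤ C
    rw [NNReal.dist_eq]
    have h1 : ((f x : ℝ≥0) : ℝ) ≤ C := by exact_mod_cast hC x
    have h2 : ((f y : ℝ≥0) : ℝ) ≤ C := by exact_mod_cast hC y
    have h3 : (0 : ℝ) ≤ f x := (f x).coe_nonneg
    have h4 : (0 : ℝ) ≤ f y := (f y).coe_nonneg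
    rw [abs_le]; constructor <;> linarith

/-- Its values. -/
@[simp] theorem bcfOfBound_apply {X : Type*} [TopologicalSpace X] (f : X → ℝ≥0) (hf : Continuous f) (C : ℝ≥0)
    (hC : ∀ x, f x ≤ C) (x : X) : bcfOfBound f hf C hC x = f x := rfl

/-- The constant test function `1`. -/
def bcfOne (X : Type*) [TopologicalSpace X] : X →ᵇ ℝ≥0 := bcfOfBound (fun _ => 1) continuous_const 1 fun _ => le_rfl

/-- The truncated weights `G · min(e^{a}, n)` as bounded continuous functions. -/
def truncWeight {X : Type*} [TopologicalSpace X] (G : X →ᵇ ℝ≥0) (a : X → ℝ) (ha : Continuous a) (n : ℕ) :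
    X →ᵇ ℝ≥0 :=
  bcfOfBound (fun x => G x * min (Real.toNNReal (Real.exp (a x))) n)
    (G.continuous.mul ((continuous_real_toNNReal.comp (Real.continuous_exp.comp ha)).min continuous_const))
    (nndist G 0 * n) fun x => mul_le_mul' (BoundedContinuousFunction.NNReal.upper_bound G x) (min_le_right _ _)

/-- Its values in `ℝ≥0∞`. -/
theorem truncWeight_coe {X : Type*} [TopologicalSpace X] (G : X →ᵇ ℝ≥0) (a : X → ℝ) (ha : Continuous a)
    (n : ℕ) (x : X) :
    (truncWeight G a ha n x : ℝ≥0∞) = (G x : ℝ≥0∞) * min (ENNReal.ofReal (Real.exp (a x))) n := by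
  show ((G x * min (Real.toNNReal (Real.exp (a x))) n : ℝ≥0) : ℝ≥0∞) = _
  rw [ENNReal.coe_mul, ENNReal.coe_min]
  rfl

/-- The truncated weights are dominated by the full weight. -/
theorem truncWeight_le {X : Type*} [TopologicalSpace X] (G : X →ᵇ ℝ≥0) (a : X → ℝ) (ha : Continuous a)
    (n : ℕ) (x : X) : (truncWeight G a ha n x : ℝ≥0∞) ≤ (G x : ℝ≥0∞) * ENNReal.ofReal (Real.exp (a x)) := by
  rw [truncWeight_coe]
  exact mul_le_mul' le_rfl (min_le_left _ _)

/-- The truncated weights against the inverse weight are monotone in `n`. -/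
theorem monotone_truncWeight_mul {X : Type*} [TopologicalSpace X] (G : X →ᵇ ℝ≥0) (a : X → ℝ) (ha : Continuous a)
    (x : X) : Monotone fun n : ℕ => (truncWeight G a ha n x : ℝ≥0∞) * ENNReal.ofReal (Real.exp (-a x)) := by
  intro n n' h
  simp only [truncWeight_coe]
  refine mul_le_mul' (mul_le_mul' le_rfl (min_le_min_left _ ?_)) le_rfl
  exact_mod_cast h

/-- The truncated weights against the inverse weight increase to `G`. -/
theorem iSup_truncWeight_mul {X : Type*} [TopologicalSpace X] (G : X →ᵇ ℝ≥0) (a : X → ℝ) (ha : Continuous a)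
    (x : X) : (⨆ n : ℕ, (truncWeight G a ha n x : ℝ≥0∞) * ENNReal.ofReal (Real.exp (-a x))) = G x := by
  have hprod : ENNReal.ofReal (Real.exp (a x)) * ENNReal.ofReal (Real.exp (-a x)) = 1 := by
    rw [← ENNReal.ofReal_mul (Real.exp_pos _).le, ← Real.exp_add, add_neg_cancel, Real.exp_zero, ENNReal.ofReal_one]
  refine le_antisymm (iSup_le fun n => ?_) ?_
  · calc (truncWeight G a ha n x : ℝ≥0∞) * ENNReal.ofReal (Real.exp (-a x))
        ≤ (G x : ℝ≥0∞) * ENNReal.ofReal (Real.exp (a x)) * ENNReal.ofReal (Real.exp (-a x)) :=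
          mul_le_mul' (truncWeight_le G a ha n x) le_rfl
      _ = G x := by rw [mul_assoc, hprod, mul_one]
  · obtain ⟨n, hn⟩ := exists_nat_ge (Real.exp (a x))
    refine le_iSup_of_le n (le_of_eq ?_)
    rw [truncWeight_coe, min_eq_left, mul_assoc, hprod, mul_one]
    rw [← ENNReal.ofReal_natCast]
    exact ENNReal.ofReal_le_ofReal hn

end BCF

/-- **Path bounds on `[0, t]` are measurable events (dyadic reduction)** — `∀`-form registered as a sub-goal of the crux item. -/
theorem measurableSet_pathBound :
    ∀ (u : ℝ → ((NNReal → ℝ) × (NNReal → ℝ)) → ℝ), (∀ ω, Continuous fun s => u s ω) → (∀ s, Measurable (u s)) → ∀ (t : ℝ), 0 ≤ t → ∀ (c : ℝ), MeasurableSet {ω | ∀ s ∈ Set.Icc 0 t, u s ω ≤ c} :=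
  fun _ hc hm _ ht c => measurableSet_forall_Icc_le hc hm ht c

end Summit.AtomisticToContinuum.FouriersLaw.Theorems.LinearResponseFTUR

end
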